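import Mathlib.Topology.MetricSpace.Bounded
import Mathlib.Analysis.Normed.Lp.PiLp
import Literature.Analysis.FluidPDE.StatisticalSolutionProofs
import HarnessLib

/-!
# Rellich's lemma on the torus energy space: enstrophy balls are compact in `H`

For the energy space `H = L²_σ(T^d)` of incompressible hydrodynamics
(`Torus.energySpace d`, real mean-zero solenoidal `L²` fields) and the spectral enstrophy
`‖∇u‖₂² = 4π² ∑ₖ |k|² ‖û(k)‖²` (`Torus.eGradNormSq`), the sublevel sets

  `K_R = {u ∈ H | ‖∇u‖₂² ≤ R}`,  `R < ∞`,

are **compact in the norm topology of `H`** (`Torus.isCompact_setOf_eGradNormSq_le`). This is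
the compactness of the embedding `V ⊂ H` on the torus (Rellich's lemma; Foias–Manley–Rosa–Temam
2001, Ch. I §4, (4.29), and Ch. II §6; Temam 1995, Ch. I §2), in the form consumed by tightness
arguments for measures on `H` (time-average measures, FMRT Ch. IV §3).

Proof (spectral, elementary): `K_R` is closed because `u ↦ ‖∇u‖₂²` is lower semicontinuous on
`H` — a supremum of finite sums of the continuous functions `u ↦ |k|² ‖û(k)‖²`
(`Torus.lowerSemicontinuous_eGradNormSq_coe`) —, complete as a closed subset of the Hilbert space
`H`, and totally bounded: by Parseval, for `N ≥ 1` and `S ⊇ {|k|² ≤ N}`,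

  `‖u − v‖² ≤ ∑_{k ∈ S} ‖û(k) − v̂(k)‖² + ‖∇(u − v)‖₂² / N ≤ ∑_{k ∈ S} ‖û(k) − v̂(k)‖² + 4R/N`

(`Torus.dist_sq_le_sum_add_of_eGradNormSq_le`), and the finitely many low modes
`u ↦ (û(k))_{k ∈ S}` range in a bounded subset of a finite-dimensional space (Poincaré,
`‖u‖² ≤ ‖∇u‖₂²` on `H`), which is totally bounded; Mathlib's
`Metric.totallyBounded_of_finite_discretization` assembles the two.

## Mathlib / Literature search

Used from the Literature: Parseval on `L²(T^d; ℝ^d)` (`Torus.enorm_sq_coe_eq_tsum`,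
`Torus.hasSum_sq_norm_mFourierCoeff_complexify`), continuity and additivity of the coefficient
maps (`Torus.continuous_mFourierCoeff_complexify_coe`, `Torus.mFourierCoeff_complexify_coe_sub`),
the Poincaré inequality on `H` (`Torus.enorm_sq_le_eGradNormSq`) and `Torus.eGradNormSq_eq_tsum`.
Mathlib has no Rellich/Kondrachov theorem (searched `Rellich`, `compact embedding`: nothing); the
tree has Rellich–Kondrachov only for Sobolev spaces on Lipschitz *domains*
(`SobolevTraceRellichProofs`, sequential form), not for the torus energy space.

## References

* C. Foias, O. Manley, R. Rosa, R. Temam, *Navier–Stokes Equations and Turbulence*, CUP 2001,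
  Ch. I §4 (4.29) (Rellich lemma), Ch. II §6 (compactness of `V ⊂ H`, `A⁻¹` compact). [FMRT2001]
-/

noncomputable section

open MeasureTheory Filter Topology UnitAddTorus Set
open scoped ENNReal NNReal

namespace Literature.Analysis.FluidPDE

namespace Torus

variable {d : Type*} [Fintype d]

/-- Local notation for the real Hilbert space `L²(T^d; ℝ^d)`. -/
local notation "L2T " d':max => Lp (EuclideanSpace ℝ d') 2 (volume : Measure (UnitAddTorus d'))

/-- Local notation for real vector fields `T^d → ℝ^d` (the target of the `Lp` coercion). -/
local notation "Vec " d':max => UnitAddTorus d' → EuclideanSpace ℝ d'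

/-! ### Elementary inequalities -/

/-- The spectral dissipation of a difference of `L²` classes:
`‖∇(u − v)‖₂² ≤ 2‖∇u‖₂² + 2‖∇v‖₂²` (termwise `‖û(k) − v̂(k)‖² ≤ 2‖û(k)‖² + 2‖v̂(k)‖²` on the
Fourier side, `Torus.mFourierCoeff_complexify_coe_sub`). [folklore] -/
theorem eGradNormSq_coe_sub_le (u v : L2T d) :
    FunctionSpaces.Torus.eGradNormSq ((u - v : L2T d) : Vec d) ≤
      2 * FunctionSpaces.Torus.eGradNormSq (u : Vec d) +
        2 * FunctionSpaces.Torus.eGradNormSq (v : Vec d) := by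
  simp only [FunctionSpaces.Torus.eGradNormSq_eq_tsum]
  set C : ℝ≥0∞ := ENNReal.ofReal (4 * Real.pi ^ 2) with hC
  set F : L2T d → (d → ℤ) → ℝ≥0∞ := fun w k =>
    ENNReal.ofReal (FunctionSpaces.Torus.freqNormSq k) *
      ‖mFourierCoeff (FunctionSpaces.EuclideanSpace.complexify ∘ (w : Vec d)) k‖ₑ ^ 2 with hF
  -- `‖a − b‖ₑ² ≤ 2‖a‖ₑ² + 2‖b‖ₑ²` in `ℂ^d`
  have hsq : ∀ a b : EuclideanSpace ℂ d, ‖a - b‖ₑ ^ 2 ≤ 2 * ‖a‖ₑ ^ 2 + 2 * ‖b‖ₑ ^ 2 := by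
    intro a b
    have h : ‖a - b‖ ^ 2 ≤ 2 * ‖a‖ ^ 2 + 2 * ‖b‖ ^ 2 := by
      have h1 := mul_self_le_mul_self (norm_nonneg _) (norm_sub_le a b)
      nlinarith [h1, sq_nonneg (‖a‖ - ‖b‖)]
    have e : ∀ x : EuclideanSpace ℂ d, ‖x‖ₑ ^ 2 = ENNReal.ofReal (‖x‖ ^ 2) := fun x => by
      rw [← ofReal_norm, ENNReal.ofReal_pow (norm_nonneg _)]
    calc ‖a - b‖ₑ ^ 2 = ENNReal.ofReal (‖a - b‖ ^ 2) := e _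
      _ ≤ ENNReal.ofReal (2 * ‖a‖ ^ 2 + 2 * ‖b‖ ^ 2) := ENNReal.ofReal_le_ofReal h
      _ = 2 * ‖a‖ₑ ^ 2 + 2 * ‖b‖ₑ ^ 2 := by
          rw [ENNReal.ofReal_add (by positivity) (by positivity), ENNReal.ofReal_mul zero_le_two,
            ENNReal.ofReal_mul zero_le_two, ENNReal.ofReal_ofNat, e a, e b]
  have hterm : ∀ k, F (u - v) k ≤ 2 * F u k + 2 * F v k := fun k => by
    simp only [hF]
    rw [mFourierCoeff_complexify_coe_sub u v k, mul_left_comm 2, mul_left_comm 2, ← mul_add]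
    gcongr
    exact hsq _ _
  calc C * ∑' k, F (u - v) k ≤ C * ∑' k, (2 * F u k + 2 * F v k) := by
        gcongr with k
        exact hterm k
    _ = 2 * (C * ∑' k, F u k) + 2 * (C * ∑' k, F v k) := by
        rw [ENNReal.tsum_add, ENNReal.tsum_mul_left, ENNReal.tsum_mul_left]
        ring

/-! ### Lower semicontinuity of the enstrophy on `H`; closed sublevel sets -/

section LSC

variable [DecidableEq d]

/-- The spectral enstrophy `u ↦ ‖∇u‖₂² = 4π² ∑ₖ |k|² ‖û(k)‖² ∈ [0, ∞]` is lower semicontinuous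
on `H` (norm topology): the series is the supremum of its finite partial sums, each a continuous
function of `u` (Fatou for series; FMRT 2001, Ch. II §6). [folklore] -/
theorem lowerSemicontinuous_eGradNormSq_coe :
    LowerSemicontinuous fun u : FunctionSpaces.Torus.energySpace d =>
      FunctionSpaces.Torus.eGradNormSq ((u : L2T d) : Vec d) := by
  have h : (fun u : FunctionSpaces.Torus.energySpace d =>
      FunctionSpaces.Torus.eGradNormSq ((u : L2T d) : Vec d)) =
      (fun x => ENNReal.ofReal (4 * Real.pi ^ 2) * x) ∘
        fun u : FunctionSpaces.Torus.energySpace d => ⨆ s : Finset (d → ℤ), ∑ k ∈ s,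
          ENNReal.ofReal (FunctionSpaces.Torus.freqNormSq k) *
            ‖mFourierCoeff
              (FunctionSpaces.EuclideanSpace.complexify ∘ ((u : L2T d) : Vec d)) k‖ₑ ^ 2 := by
    funext u
    simp only [Function.comp_apply]
    rw [FunctionSpaces.Torus.eGradNormSq_eq_tsum, ENNReal.tsum_eq_iSup_sum]
  rw [h]
  refine (ENNReal.continuous_const_mul ENNReal.ofReal_ne_top).comp_lowerSemicontinuous
    (lowerSemicontinuous_iSup fun s => Continuous.lowerSemicontinuous ?_)
    fun a b hab => by dsimp only; gcongr
  refine continuous_finsetSum s fun k _ => ?_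
  exact (ENNReal.continuous_const_mul ENNReal.ofReal_ne_top).comp
    ((ENNReal.continuous_pow 2).comp
      ((continuous_mFourierCoeff_complexify_coe k).comp continuous_subtype_val).enorm)

/-- The enstrophy balls `{u ∈ H | ‖∇u‖₂² ≤ R}` are closed in `H` (sublevel sets of a lower
semicontinuous function). [folklore] -/
theorem isClosed_setOf_eGradNormSq_le (R : ℝ≥0∞) :
    IsClosed {u : FunctionSpaces.Torus.energySpace d |
      FunctionSpaces.Torus.eGradNormSq ((u : L2T d) : Vec d) ≤ R} :=
  lowerSemicontinuous_eGradNormSq_coe.isClosed_preimage R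

end LSC

/-! ### The tail estimate (Parseval) -/

/-- **Low/high frequency splitting.** For `w ∈ L²(T^d; ℝ^d)`, `N ≥ 1` and a finite set of
frequencies `S ⊇ {k : |k|² ≤ N}`:
`‖w‖² ≤ ∑_{k ∈ S} ‖ŵ(k)‖² + ‖∇w‖₂² / N` (Parseval `‖w‖² = ∑ₖ ‖ŵ(k)‖²`, and `1 ≤ |k|²/N` at the
high modes; the factor `4π² ≥ 1` of `eGradNormSq` is discarded). [folklore] -/
theorem enorm_sq_le_sum_add_eGradNormSq_div (w : L2T d) {N : ℕ} (hN : 0 < N)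
    (S : Finset (d → ℤ)) (hS : ∀ k, FunctionSpaces.Torus.freqNormSq k ≤ N → k ∈ S) :
    ‖w‖ₑ ^ 2 ≤ (∑ k ∈ S,
        ‖mFourierCoeff (FunctionSpaces.EuclideanSpace.complexify ∘ (w : Vec d)) k‖ₑ ^ 2) +
      FunctionSpaces.Torus.eGradNormSq (w : Vec d) / N := by
  set c : (d → ℤ) → ℝ≥0∞ := fun k =>
    ‖mFourierCoeff (FunctionSpaces.EuclideanSpace.complexify ∘ (w : Vec d)) k‖ₑ ^ 2 with hc
  have hN' : (N : ℝ≥0∞) ≠ 0 := by exact_mod_cast hN.ne'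
  have hterm : ∀ k, c k ≤ (if k ∈ S then c k else 0) +
      ENNReal.ofReal (FunctionSpaces.Torus.freqNormSq k) * c k / N := by
    intro k
    by_cases hk : k ∈ S
    · rw [if_pos hk]
      exact le_self_add
    · rw [if_neg hk, zero_add]
      have hNk : (N : ℝ) ≤ FunctionSpaces.Torus.freqNormSq k :=
        (lt_of_not_ge fun h => hk (hS k h)).le
      have h1 : (1 : ℝ≥0∞) ≤ ENNReal.ofReal (FunctionSpaces.Torus.freqNormSq k) / N := by
        rw [ENNReal.le_div_iff_mul_le (Or.inl hN') (Or.inl (ENNReal.natCast_ne_top N)), one_mul,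
          ← ENNReal.ofReal_natCast]
        exact ENNReal.ofReal_le_ofReal hNk
      calc c k = 1 * c k := (one_mul _).symm
        _ ≤ (ENNReal.ofReal (FunctionSpaces.Torus.freqNormSq k) / N) * c k := by
            gcongr
        _ = ENNReal.ofReal (FunctionSpaces.Torus.freqNormSq k) * c k / N := by
            rw [div_eq_mul_inv, div_eq_mul_inv, mul_right_comm]
  have hsplit : ∑' k, ((if k ∈ S then c k else 0) +
      ENNReal.ofReal (FunctionSpaces.Torus.freqNormSq k) * c k / N) =
      (∑ k ∈ S, c k) +
        (∑' k, ENNReal.ofReal (FunctionSpaces.Torus.freqNormSq k) * c k) / N := by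
    rw [ENNReal.tsum_add]
    congr 1
    · rw [tsum_eq_sum (s := S) fun k hk => if_neg hk]
      exact Finset.sum_congr rfl fun k hk => if_pos hk
    · simp_rw [div_eq_mul_inv]
      rw [ENNReal.tsum_mul_right]
  have hgrad : (∑' k, ENNReal.ofReal (FunctionSpaces.Torus.freqNormSq k) * c k) ≤
      FunctionSpaces.Torus.eGradNormSq (w : Vec d) := by
    rw [FunctionSpaces.Torus.eGradNormSq_eq_tsum]
    refine le_mul_of_one_le_left bot_le (ENNReal.one_le_ofReal.2 ?_)
    nlinarith [Real.two_le_pi]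
  calc ‖w‖ₑ ^ 2 = ∑' k, c k := enorm_sq_coe_eq_tsum w
    _ ≤ ∑' k, ((if k ∈ S then c k else 0) +
          ENNReal.ofReal (FunctionSpaces.Torus.freqNormSq k) * c k / N) :=
        ENNReal.tsum_le_tsum hterm
    _ = (∑ k ∈ S, c k) +
          (∑' k, ENNReal.ofReal (FunctionSpaces.Torus.freqNormSq k) * c k) / N := hsplit
    _ ≤ (∑ k ∈ S, c k) + FunctionSpaces.Torus.eGradNormSq (w : Vec d) / N := by
        gcongr

variable [DecidableEq d]

/-- **Distance control by low modes on an enstrophy ball** (the quantitative Rellich estimate):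
for `u, v ∈ H` with `‖∇u‖₂², ‖∇v‖₂² ≤ R < ∞`, `N ≥ 1` and `S ⊇ {k : |k|² ≤ N}`,
`‖u − v‖² ≤ ∑_{k ∈ S} ‖û(k) − v̂(k)‖² + 4R/N` (the tail estimate for `w = u − v` and
`‖∇(u − v)‖₂² ≤ 2‖∇u‖₂² + 2‖∇v‖₂²`; FMRT 2001, Ch. II §6). [folklore] -/
theorem dist_sq_le_sum_add_of_eGradNormSq_le {R : ℝ≥0∞} (hR : R ≠ ∞)
    {u v : FunctionSpaces.Torus.energySpace d}
    (hu : FunctionSpaces.Torus.eGradNormSq ((u : L2T d) : Vec d) ≤ R)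
    (hv : FunctionSpaces.Torus.eGradNormSq ((v : L2T d) : Vec d) ≤ R)
    {N : ℕ} (hN : 0 < N) (S : Finset (d → ℤ))
    (hS : ∀ k, FunctionSpaces.Torus.freqNormSq k ≤ N → k ∈ S) :
    dist u v ^ 2 ≤ (∑ k ∈ S,
        ‖mFourierCoeff (FunctionSpaces.EuclideanSpace.complexify ∘ ((u : L2T d) : Vec d)) k -
          mFourierCoeff (FunctionSpaces.EuclideanSpace.complexify ∘ ((v : L2T d) : Vec d)) k‖ ^ 2) +
      4 * R.toReal / N := by
  have h1 := enorm_sq_le_sum_add_eGradNormSq_div ((u : L2T d) - (v : L2T d)) hN S hS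
  simp only [mFourierCoeff_complexify_coe_sub] at h1
  have h2 : FunctionSpaces.Torus.eGradNormSq (((u : L2T d) - (v : L2T d) : L2T d) : Vec d) ≤
      2 * R + 2 * R :=
    (eGradNormSq_coe_sub_le _ _).trans (by gcongr)
  have h3 : ‖(u : L2T d) - (v : L2T d)‖ₑ ^ 2 ≤ (∑ k ∈ S,
      ‖mFourierCoeff (FunctionSpaces.EuclideanSpace.complexify ∘ ((u : L2T d) : Vec d)) k -
        mFourierCoeff (FunctionSpaces.EuclideanSpace.complexify ∘ ((v : L2T d) : Vec d)) k‖ₑ ^ 2) +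
      (2 * R + 2 * R) / N :=
    h1.trans (by gcongr)
  -- convert to real numbers
  have hdist : dist u v = ‖(u : L2T d) - (v : L2T d)‖ := by
    rw [Subtype.dist_eq, dist_eq_norm]
  have eL : ‖(u : L2T d) - (v : L2T d)‖ₑ ^ 2 = ENNReal.ofReal (dist u v ^ 2) := by
    rw [hdist, ← ofReal_norm, ENNReal.ofReal_pow (norm_nonneg _)]
  have eS : (∑ k ∈ S,
      ‖mFourierCoeff (FunctionSpaces.EuclideanSpace.complexify ∘ ((u : L2T d) : Vec d)) k -
        mFourierCoeff (FunctionSpaces.EuclideanSpace.complexify ∘ ((v : L2T d) : Vec d)) k‖ₑ ^ 2) =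
      ENNReal.ofReal (∑ k ∈ S,
        ‖mFourierCoeff (FunctionSpaces.EuclideanSpace.complexify ∘ ((u : L2T d) : Vec d)) k -
          mFourierCoeff
            (FunctionSpaces.EuclideanSpace.complexify ∘ ((v : L2T d) : Vec d)) k‖ ^ 2) := by
    rw [ENNReal.ofReal_sum_of_nonneg fun k _ => sq_nonneg _]
    exact Finset.sum_congr rfl fun k _ => by rw [← ofReal_norm, ENNReal.ofReal_pow (norm_nonneg _)]
  have eR : (2 * R + 2 * R) / N = ENNReal.ofReal (4 * R.toReal / N) := by
    rw [ENNReal.ofReal_div_of_pos (by exact_mod_cast hN), ENNReal.ofReal_mul (by norm_num),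
      ENNReal.ofReal_toReal hR, ENNReal.ofReal_natCast, ENNReal.ofReal_ofNat]
    congr 1
    ring
  rw [eL, eS, eR, ← ENNReal.ofReal_add (Finset.sum_nonneg fun k _ => sq_nonneg _)
    (by positivity)] at h3
  exact (ENNReal.ofReal_le_ofReal_iff (add_nonneg (Finset.sum_nonneg fun k _ => sq_nonneg _)
    (by positivity))).1 h3

/-- On an enstrophy ball the `L²` norm is bounded: `‖∇u‖₂² ≤ R` implies `‖u‖² ≤ R` for `u ∈ H`
(Poincaré on the mean-zero space `H`, `Torus.enorm_sq_le_eGradNormSq`). [folklore] -/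
theorem norm_sq_le_of_eGradNormSq_le {R : ℝ≥0∞} (hR : R ≠ ∞)
    {u : FunctionSpaces.Torus.energySpace d}
    (hu : FunctionSpaces.Torus.eGradNormSq ((u : L2T d) : Vec d) ≤ R) : ‖u‖ ^ 2 ≤ R.toReal := by
  have h := (enorm_sq_le_eGradNormSq u).trans hu
  rw [← ofReal_norm, ← ENNReal.ofReal_pow (norm_nonneg _), ← ENNReal.ofReal_toReal hR] at h
  exact (ENNReal.ofReal_le_ofReal_iff ENNReal.toReal_nonneg).1 h

omit [DecidableEq d] in
/-- The set of frequencies `{k ∈ ℤ^d : |k|² ≤ N}` is finite (it lies in the box `[−N, N]^d`).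
[folklore] -/
theorem finite_setOf_freqNormSq_le (N : ℕ) :
    {k : d → ℤ | FunctionSpaces.Torus.freqNormSq k ≤ N}.Finite := by
  refine (Set.Finite.pi fun _ : d => Set.finite_Icc (-(N : ℤ)) (N : ℤ)).subset fun k hk => ?_
  rw [Set.mem_setOf_eq] at hk
  have hki : ∀ i, (k i : ℝ) ^ 2 ≤ N := fun i =>
    (Finset.single_le_sum (f := fun j => (k j : ℝ) ^ 2) (fun j _ => sq_nonneg _)
      (Finset.mem_univ i)).trans hk
  have hki' : ∀ i, (k i) ^ 2 ≤ (N : ℤ) := fun i => by exact_mod_cast hki i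
  refine Set.mem_univ_pi.2 fun i => ⟨?_, ?_⟩
  · nlinarith [hki' i, sq_nonneg (k i + 1)]
  · nlinarith [hki' i, sq_nonneg (k i - 1)]

/-! ### Compactness -/

/-- **Rellich's lemma on the torus energy space.** For `R < ∞` the enstrophy ball
`{u ∈ H | ‖∇u‖₂² ≤ R}` is compact in the norm topology of `H = L²_σ(T^d)` (compactness of the
embedding `V ⊂ H`; Foias–Manley–Rosa–Temam 2001, Ch. I §4 (4.29) and Ch. II §6). Proof: closed
(lower semicontinuity) and complete; totally bounded by the low/high mode splitting
`‖u − v‖² ≤ ∑_{|k|² ≤ N} ‖û(k) − v̂(k)‖² + 4R/N` and total boundedness of bounded sets in the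
finite-dimensional space of low modes. [cite: FMRT2001, Ch. I §4 (4.29); Ch. II §6] -/
theorem isCompact_setOf_eGradNormSq_le {R : ℝ≥0∞} (hR : R ≠ ∞) :
    IsCompact {u : FunctionSpaces.Torus.energySpace d |
      FunctionSpaces.Torus.eGradNormSq ((u : L2T d) : Vec d) ≤ R} := by
  set K := {u : FunctionSpaces.Torus.energySpace d |
    FunctionSpaces.Torus.eGradNormSq ((u : L2T d) : Vec d) ≤ R} with hK
  rw [isCompact_iff_totallyBounded_isComplete]
  refine ⟨?_, (isClosed_setOf_eGradNormSq_le R).isComplete⟩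
  refine Metric.totallyBounded_of_finite_discretization fun ε hε => ?_
  set r : ℝ := R.toReal with hr
  have hr0 : 0 ≤ r := ENNReal.toReal_nonneg
  -- frequency cutoff `N` with `4 r / N ≤ ε² / 4`
  obtain ⟨N, hN⟩ := exists_nat_gt (16 * r / ε ^ 2)
  have hNpos : 0 < N := Nat.cast_pos.1 ((by positivity : (0 : ℝ) ≤ 16 * r / ε ^ 2).trans_lt hN)
  have htail : 4 * r / N ≤ ε ^ 2 / 4 := by
    rw [div_le_iff₀ (by exact_mod_cast hNpos : (0 : ℝ) < N)]
    rw [div_lt_iff₀ (by positivity)] at hN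
    nlinarith
  -- the finite set of low frequencies
  obtain ⟨S, hS'⟩ : ∃ S : Finset (d → ℤ), ∀ k, FunctionSpaces.Torus.freqNormSq k ≤ N → k ∈ S :=
    ⟨(finite_setOf_freqNormSq_le N).toFinset, fun k hk =>
      (finite_setOf_freqNormSq_le N).mem_toFinset.2 hk⟩
  -- the low-mode map into a finite-dimensional space
  let P : FunctionSpaces.Torus.energySpace d → PiLp 2 (fun _ : ↥S => EuclideanSpace ℂ d) := fun u =>
    WithLp.toLp 2 fun k =>
      mFourierCoeff (FunctionSpaces.EuclideanSpace.complexify ∘ ((u : L2T d) : Vec d)) k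
  have hPsub : ∀ u v : FunctionSpaces.Torus.energySpace d, dist (P u) (P v) ^ 2 = ∑ k ∈ S,
      ‖mFourierCoeff (FunctionSpaces.EuclideanSpace.complexify ∘ ((u : L2T d) : Vec d)) k -
        mFourierCoeff
          (FunctionSpaces.EuclideanSpace.complexify ∘ ((v : L2T d) : Vec d)) k‖ ^ 2 := by
    intro u v
    rw [dist_eq_norm, PiLp.norm_sq_eq_of_L2]
    simp only [P, PiLp.sub_apply]
    exact Finset.sum_coe_sort S fun k =>
      ‖mFourierCoeff (FunctionSpaces.EuclideanSpace.complexify ∘ ((u : L2T d) : Vec d)) k -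
        mFourierCoeff (FunctionSpaces.EuclideanSpace.complexify ∘ ((v : L2T d) : Vec d)) k‖ ^ 2
  have hPbound : ∀ u ∈ K, ‖P u‖ ≤ Real.sqrt r := by
    intro u hu
    have hsum := FunctionSpaces.Torus.hasSum_sq_norm_mFourierCoeff_complexify (Lp.memLp (u : L2T d))
    rw [integral_norm_sq_coe_eq] at hsum
    have h1 : ‖P u‖ ^ 2 ≤ ‖(u : L2T d)‖ ^ 2 := by
      rw [PiLp.norm_sq_eq_of_L2]
      simp only [P]
      rw [Finset.sum_coe_sort S fun k =>
        ‖mFourierCoeff (FunctionSpaces.EuclideanSpace.complexify ∘ ((u : L2T d) : Vec d)) k‖ ^ 2]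
      exact sum_le_hasSum S (fun k _ => sq_nonneg _) hsum
    have h2 : ‖(u : L2T d)‖ ^ 2 ≤ r := norm_sq_le_of_eGradNormSq_le hR hu
    calc ‖P u‖ = Real.sqrt (‖P u‖ ^ 2) := (Real.sqrt_sq (norm_nonneg _)).symm
      _ ≤ Real.sqrt r := Real.sqrt_le_sqrt (h1.trans h2)
  -- the image of `K` is totally bounded: pick a finite `ε/4`-net
  have htb : TotallyBounded (P '' K) :=
    (isCompact_closedBall (0 : PiLp 2 (fun _ : ↥S => EuclideanSpace ℂ d))
      (Real.sqrt r)).totallyBounded.subset (by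
        rintro _ ⟨u, hu, rfl⟩
        exact mem_closedBall_zero_iff.2 (hPbound u hu))
  obtain ⟨t, htfin, hcover⟩ := Metric.totallyBounded_iff.1 htb (ε / 4) (by positivity)
  haveI : Fintype t := htfin.fintype
  have hchoice : ∀ x : K, ∃ y : t, dist (P x) y < ε / 4 := fun x => by
    have hx := hcover ⟨x, x.2, rfl⟩
    simp only [Set.mem_iUnion, Metric.mem_ball, exists_prop] at hx
    obtain ⟨y, hy, hxy⟩ := hx
    exact ⟨⟨y, hy⟩, hxy⟩
  choose F hF using hchoice
  refine ⟨t, inferInstance, F, fun x y hxy => ?_⟩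
  have hP : dist (P x) (P y) < ε / 2 :=
    calc dist (P x) (P y) ≤ dist (P x) (F x) + dist (P y) (F x) := dist_triangle_right _ _ _
      _ < ε / 4 + ε / 4 := by
          refine add_lt_add (hF x) ?_
          rw [hxy]
          exact hF y
      _ = ε / 2 := by ring
  have hkey := dist_sq_le_sum_add_of_eGradNormSq_le hR x.2 y.2 hNpos S hS'
  rw [← hPsub] at hkey
  have hP2 : dist (P x) (P y) ^ 2 < (ε / 2) ^ 2 := pow_lt_pow_left₀ hP dist_nonneg two_ne_zero
  have hlt : dist (x : FunctionSpaces.Torus.energySpace d) y ^ 2 < ε ^ 2 := by nlinarith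
  exact lt_of_pow_lt_pow_left₀ 2 hε.le hlt

end Torus

end Literature.Analysis.FluidPDE
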